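import Literature.Geometry.Riemannian.CurvatureOperatorFormFrame
import Literature.Geometry.Riemannian.HamiltonCurvatureODEProofs
import Literature.Geometry.Riemannian.HamiltonPCOPinchingSet
import HarnessLib

/-!
# The Ricci flow on a closed 4-manifold preserves positive curvature operator, and the pinching
# set of Thm. 7.1 is reached unconditionally (topic `Geometry/Riemannian`)

Bricks of the printed proof of the named fact
`Literature.Geometry.Riemannian.hamilton_positiveCurvatureOperator_classification_four`
(**Hamilton 1986, Thm. 1.1**; `HamiltonPCOClassification.lean`, reduced in the tree to
(H1) = convergence of the normalised Ricci flow, `HamiltonPCOClassificationKillingHopf.lean`).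
Hamilton's maximum principle for systems (1986, §4, Thm. 4.3) is now a theorem of the tree
(`hamilton_maximumPrinciple_curvatureODE_holds`, `HamiltonCurvatureODEProofs.lean`), so the two
ODE-to-PDE statements of §7 that were proved modulo that named fact become unconditional:

* `ricciFlow_operatorGE_of_hasPositiveCurvatureOperatorWith'`,
  `ricciFlow_preserves_hasPositiveCurvatureOperatorWith`,
  `ricciFlow_preserves_hasPositiveCurvatureOperator` — **along a Ricci flow of Riemannian metrics
  on `[0, T)` on a closed smooth 4-manifold, positive curvature operator is preserved**, uniformly
  (`M ≥ m > 0` in every orthonormal frame at every time; Hamilton 1986, §7, p. 171: "if `M > 0` at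
  the start ... it remains so"), in the block language, in the 2-vector language of p. 153 for the
  flow's Levi-Civita connections, and for the metric-level notion `HasPositiveCurvatureOperator`
  (all Levi-Civita connections; the dictionary `hasPositiveCurvatureOperatorWith_of_quad_blocks_pos`
  of `CurvatureOperatorFormFrame.lean`);
* `ricciFlow_pinchingSet_of_hasPositiveCurvatureOperator` — **Thm. 7.1 with §4 along the flow,
  unconditionally**: an initial metric of positive curvature operator evolves, for all
  `t ∈ [0, T)`, inside one pinching set `Z = pcoPinchingFive m G H J δ K ε L θ` with admissible
  constants (`ricciFlow_pinchingSet_of_hasPositiveCurvatureOperatorWith` of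
  `HamiltonPCOPinchingSet.lean` fed with `hamilton_maximumPrinciple_curvatureODE_holds`) — the
  pinching estimate that the convergence criterion 5.2 consumes (p. 164: "Then it will remain in
  `X` by the argument in §4. This gives us the required pinching estimate").

Theorems only: no definitions, no named facts (D-0026).

## References

* R. S. Hamilton, *Four-manifolds with positive curvature operator*, J. Differential Geom. 24
  (1986) 153–179: §1 (p. 153), §4, Thm. 4.3 (p. 162), §5, 5.2 (p. 164), §7, Thm. 7.1
  (pp. 170–171). [Hamilton1986]
-/

noncomputable section

open Set Function Module
open scoped Manifold ContDiff

universe u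

namespace Literature.Geometry.Riemannian

open Lorentzian Lorentzian.PseudoRiemannianMetric HamiltonODE

/-- **`M ≥ m > 0` is preserved, unconditionally**: along a Ricci flow `(g, cov)` of Riemannian
metrics on `[0, T)` on a closed smooth 4-manifold whose initial pair has positive curvature
operator, there is `m > 0` with `M = (A B; ᵗB C) ≥ m` in every `g t`-orthonormal frame at every
`t ∈ [0, T)` (`ricciFlow_operatorGE_of_hasPositiveCurvatureOperatorWith` with the maximum
principle `hamilton_maximumPrinciple_curvatureODE_holds`). [cite: Hamilton1986, §7, p. 171; §4, Thm. 4.3 (p. 162)] -/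
theorem ricciFlow_operatorGE_of_hasPositiveCurvatureOperatorWith'
    (M : Type u) [TopologicalSpace M] [T2Space M] [SecondCountableTopology M] [CompactSpace M]
    [ChartedSpace (EuclideanSpace ℝ (Fin 4)) M] [IsManifold (𝓡 4) ∞ M] (T : ℝ)
    (g : ℝ → PseudoRiemannianMetric (𝓡 4) ∞ (EuclideanSpace ℝ (Fin 4))
      (TangentSpace (𝓡 4) : M → Type _))
    (cov : ℝ → CovariantDerivative (𝓡 4) (EuclideanSpace ℝ (Fin 4))
      (TangentSpace (𝓡 4) : M → Type _))
    (hflow : IsRicciFlow g cov (Ico 0 T)) (hRiem : ∀ t ∈ Ico 0 T, (g t).IsRiemannian)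
    (hR : (g 0).HasPositiveCurvatureOperatorWith (cov 0)) :
    ∃ m : ℝ, 0 < m ∧ ∀ t ∈ Ico 0 T, ∀ (x : M) (e : Fin 4 → TangentSpace (𝓡 4) x),
      (g t).IsOrthonormalFrame x e →
        OperatorGE ((g t).blockA (cov t) x e, (g t).blockB (cov t) x e, (g t).blockC (cov t) x e)
          m :=
  ricciFlow_operatorGE_of_hasPositiveCurvatureOperatorWith hamilton_maximumPrinciple_curvatureODE_holds
    M T g cov hflow hRiem hR

/-- **The Ricci flow on a closed 4-manifold preserves positive curvature operator** (2-vector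
language of Hamilton 1986, p. 153, for the flow's own Levi-Civita connections): if
`Rm_{g 0}(φ, φ) > 0` for all 2-vectors `φ ≠ 0` then `Rm_{g t}(φ, φ) > 0` for all `φ ≠ 0` and all
`t ∈ [0, T)` (`M ≥ m > 0` persists, and `Rm(φ, φ) = M(v, v)` at the block coordinates `v ≠ 0`
of `φ`, `hasPositiveCurvatureOperatorWith_of_quad_blocks_pos`). [cite: Hamilton1986, §7, p. 171] -/
theorem ricciFlow_preserves_hasPositiveCurvatureOperatorWith
    (M : Type u) [TopologicalSpace M] [T2Space M] [SecondCountableTopology M] [CompactSpace M]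
    [ChartedSpace (EuclideanSpace ℝ (Fin 4)) M] [IsManifold (𝓡 4) ∞ M] (T : ℝ)
    (g : ℝ → PseudoRiemannianMetric (𝓡 4) ∞ (EuclideanSpace ℝ (Fin 4))
      (TangentSpace (𝓡 4) : M → Type _))
    (cov : ℝ → CovariantDerivative (𝓡 4) (EuclideanSpace ℝ (Fin 4))
      (TangentSpace (𝓡 4) : M → Type _))
    (hflow : IsRicciFlow g cov (Ico 0 T)) (hRiem : ∀ t ∈ Ico 0 T, (g t).IsRiemannian)
    (hR : (g 0).HasPositiveCurvatureOperatorWith (cov 0)) :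
    ∀ t ∈ Ico 0 T, (g t).HasPositiveCurvatureOperatorWith (cov t) := by
  obtain ⟨m, hm, h⟩ :=
    ricciFlow_operatorGE_of_hasPositiveCurvatureOperatorWith' M T g cov hflow hRiem hR
  intro t ht
  have hn : (2 : ℕ∞ω) ≤ ∞ := WithTop.coe_le_coe.mpr le_top
  refine hasPositiveCurvatureOperatorWith_of_quad_blocks_pos finrank_euclideanSpace_fin (hRiem t ht)
    (hflow.isLeviCivita t ht) hn fun x e he v hv ↦ ?_
  have hv' : 0 < normSq v := by
    rcases (normSq_nonneg v).lt_or_eq with hlt | heq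
    · exact hlt
    · exact absurd (eq_zero_of_normSq_eq_zero heq.symm) hv
  exact lt_of_lt_of_le (mul_pos hm hv') (h t ht x e he v)

/-- **The Ricci flow on a closed 4-manifold preserves positive curvature operator** (metric-level
notion `HasPositiveCurvatureOperator`: every Levi-Civita connection of the metric, which is unique,
has `Rm(φ, φ) > 0` for `φ ≠ 0`): if `g 0` has positive curvature operator then so has every `g t`,
`t ∈ [0, T)`. Hamilton 1986, §7, p. 171. [cite: Hamilton1986, §7, p. 171; §4, Thm. 4.3 (p. 162)] -/
theorem ricciFlow_preserves_hasPositiveCurvatureOperator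
    (M : Type u) [TopologicalSpace M] [T2Space M] [SecondCountableTopology M] [CompactSpace M]
    [ChartedSpace (EuclideanSpace ℝ (Fin 4)) M] [IsManifold (𝓡 4) ∞ M] (T : ℝ)
    (g : ℝ → PseudoRiemannianMetric (𝓡 4) ∞ (EuclideanSpace ℝ (Fin 4))
      (TangentSpace (𝓡 4) : M → Type _))
    (cov : ℝ → CovariantDerivative (𝓡 4) (EuclideanSpace ℝ (Fin 4))
      (TangentSpace (𝓡 4) : M → Type _))
    (hflow : IsRicciFlow g cov (Ico 0 T)) (hRiem : ∀ t ∈ Ico 0 T, (g t).IsRiemannian)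
    (hR : (g 0).HasPositiveCurvatureOperator) :
    ∀ t ∈ Ico 0 T, (g t).HasPositiveCurvatureOperator := by
  intro t ht
  have h0 : (0 : ℝ) ∈ Ico 0 T := ⟨le_rfl, ht.1.trans_lt ht.2⟩
  have hn : (2 : ℕ∞ω) ≤ ∞ := WithTop.coe_le_coe.mpr le_top
  have hW : (g t).HasPositiveCurvatureOperatorWith (cov t) :=
    ricciFlow_preserves_hasPositiveCurvatureOperatorWith M T g cov hflow hRiem
      (hR (cov 0) (hflow.isLeviCivita 0 h0)) t ht
  rw [hasPositiveCurvatureOperator_iff_quad_blocks_pos finrank_euclideanSpace_fin (hRiem t ht)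
    (hflow.isLeviCivita t ht) hn]
  exact fun x e he v hv ↦ hW.quad_blocks_pos (hflow.isLeviCivita t ht) hn x he hv

/-- **Hamilton 1986, Thm. 7.1 with §4 along the Ricci flow, unconditionally: an initial metric of
positive curvature operator evolves inside a pinching set.** Along a Ricci flow `(g, cov)` of
Riemannian metrics on `[0, T)`, `T > 0`, on a closed smooth 4-manifold whose initial metric has
positive curvature operator, there are `m > 0` and admissible constants such that for every
`t ∈ [0, T)` the blocks of `(g t, cov t)` lie in `Z = pcoPinchingFive m G H J δ K ε L θ` in every
orthonormal frame — so the pinching estimate `pcoPinchingFive_pinching` holds along the flow, the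
hypothesis of the convergence criterion 5.2 (p. 164: "we can find a pinching set `Z` ... such that
at time `t = 0` the curvature operator `M` lies in `X = P ×_G Z`. Then it will remain in `X` by the
argument in §4. This gives us the required pinching estimate"). This is
`ricciFlow_pinchingSet_of_hasPositiveCurvatureOperatorWith` with the maximum principle for systems
supplied by `hamilton_maximumPrinciple_curvatureODE_holds`.
[cite: Hamilton1986, §7, Thm. 7.1 (p. 170); §5, 5.2 (p. 164); §4, Thm. 4.3 (p. 162)] -/
theorem ricciFlow_pinchingSet_of_hasPositiveCurvatureOperator
    (M : Type u) [TopologicalSpace M] [T2Space M] [SecondCountableTopology M] [CompactSpace M]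
    [ChartedSpace (EuclideanSpace ℝ (Fin 4)) M] [IsManifold (𝓡 4) ∞ M] (T : ℝ)
    (g : ℝ → PseudoRiemannianMetric (𝓡 4) ∞ (EuclideanSpace ℝ (Fin 4))
      (TangentSpace (𝓡 4) : M → Type _))
    (cov : ℝ → CovariantDerivative (𝓡 4) (EuclideanSpace ℝ (Fin 4))
      (TangentSpace (𝓡 4) : M → Type _))
    (hflow : IsRicciFlow g cov (Ico 0 T)) (hRiem : ∀ t ∈ Ico 0 T, (g t).IsRiemannian)
    (hR : (g 0).HasPositiveCurvatureOperator) (hT : 0 < T) :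
    ∃ m G H J δ η K ε θ L : ℝ, 0 < m ∧
      (0 < G ∧ G + 1 ≤ H ∧ 0 < δ ∧ δ ≤ 1 ∧ 8 * H * δ ≤ 1 ∧ 4 * G * H * δ ^ 2 ≤ 1 ∧ 0 < J ∧
        0 < η ∧ η ≤ 1 / 2 ∧ 16 * 8 ^ δ * J * η ^ δ ≤ 1 ∧ 0 < ε ∧ 12 * ε ≤ δ * η ∧ 144 * ε ≤ η ^ 2 ∧
        0 < K ∧ θ * (2 + ε) = 2 * ε ∧ θ ≤ 1 ∧ 6 * H * θ ≤ 1 ∧ 2 * K ^ (1 - θ / 2) ≤ L) ∧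
      ∀ t ∈ Ico 0 T, ∀ (x : M) (e : Fin 4 → TangentSpace (𝓡 4) x), (g t).IsOrthonormalFrame x e →
        ((g t).blockA (cov t) x e, (g t).blockB (cov t) x e, (g t).blockC (cov t) x e) ∈
          pcoPinchingFive m G H J δ K ε L θ :=
  ricciFlow_pinchingSet_of_hasPositiveCurvatureOperatorWith hamilton_maximumPrinciple_curvatureODE_holds
    M T g cov hflow hRiem (hR (cov 0) (hflow.isLeviCivita 0 ⟨le_rfl, hT⟩)) hT

end Literature.Geometry.Riemannian
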